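import Summits.ValiantsHypothesis.ValiantsHypothesis.Theses.RigidityForcesSymmetry
import Summits.ValiantsHypothesis.ValiantsHypothesis.Theorems.RigidityForcesSymmetryGrenetFirstOrderRankRigidPencil
import Summits.ValiantsHypothesis.ValiantsHypothesis.Theorems.RigidityForcesSymmetryGrenetFirstOrderRankRigidConstGauge
import Summits.ValiantsHypothesis.ValiantsHypothesis.Theorems.RigidityForcesSymmetryGrenetFirstOrderRankRigidBorders

/-!
# Route RigidityForcesSymmetry — `GrenetFirstOrderRankRigid` (item stmt-ValiantsHypothesis-21029): the closing
composition of line `grenet_gauge` (def-free form)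

DRY RUN against a sorried placeholder for val-width-21029-p2's announced `grenet_blockII_PQ` (the `hII` binder of
`grenet_linearRigid_of_blockII_PQ`, generic `e`, `[CharZero k]`).  At closing time: delete the placeholder, import
p2's module, replace the name.  Witness: Grenet's pencil for the enumeration `e = Fintype.equivFinOfCardEq _`
(`Λ = coeff 0`, `A_v = coeff x_v` of `Grenet.repr`); determinant from `Grenet.isAffineDetRepr_repr`; degree-0 gauge
from `grenet_constGauge`; positive degree from `grenet_linearRigid_of_blockII_PQ` + the block-II identity.
No definitions.  VP ≠ VNP is not moved by this file.
-/

noncomputable section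

open Finset MvPolynomial

namespace Summit.ValiantsHypothesis.Theorems.RigidityForcesSymmetry.GrenetGauge

open Literature.Computability.AlgebraicComplexity
open Summit.ValiantsHypothesis.ValiantsHypothesis.Theses.RigidityForcesSymmetry

/-- DRY-RUN placeholder (p2's announced `grenet_blockII_PQ`); NOT to be proposed. -/
theorem grenet_blockII_PQ_placeholder {k : Type*} [Field k] [CharZero k] {n N : ℕ} (e : Finset (Fin n) ≃ Fin (N + 1))
    (hn : n ≠ 0) (hN : 2 ^ n = N + 1) :
    ∀ (A' : Fin n × Fin n → Matrix (Fin N) (Fin N) k),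
      ((Grenet.repr k n e).adjugate * ∑ v, (X v : MvPolynomial (Fin n × Fin n) k) • (A' v).map C).trace = 0 →
      (∀ (w : Fin n × Fin n) (a b : Fin N), A' w a b ≠ 0 →
        (w.1 ∉ e.symm ((e univ).succAbove a) ∧ (w.2 : ℕ) = (e.symm ((e univ).succAbove a)).card) ∨
        (w.1 ∈ e.symm ((e ∅).succAbove b) ∧ (e.symm ((e ∅).succAbove b)).card = (w.2 : ℕ) + 1)) →
      ∀ (i j : Fin N) (v : Fin n × Fin n) (i' j' : Fin N) (v' : Fin n × Fin n),
      (v.1 ∉ e.symm ((e univ).succAbove i) ∧ (v.2 : ℕ) = (e.symm ((e univ).succAbove i)).card) →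
      ¬ (v.1 ∈ e.symm ((e ∅).succAbove j) ∧ (e.symm ((e ∅).succAbove j)).card = (v.2 : ℕ) + 1) →
      (v'.1 ∈ e.symm ((e ∅).succAbove j') ∧ (e.symm ((e ∅).succAbove j')).card = (v'.2 : ℕ) + 1) →
      ¬ (v'.1 ∉ e.symm ((e univ).succAbove i') ∧ (v'.2 : ℕ) = (e.symm ((e univ).succAbove i')).card) →
      insert v.1 (e.symm ((e univ).succAbove i)) = e.symm ((e univ).succAbove i') →
      e.symm ((e ∅).succAbove j) = (e.symm ((e ∅).succAbove j')).erase v'.1 →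
      e.symm ((e ∅).succAbove j) ⊆ e.symm ((e univ).succAbove i') →
      A' v' i' j' = -A' v i j := by
  sorry

/-- **Grenet's representation is first-order rank-rigid** (route decl `GrenetFirstOrderRankRigid`, item
stmt-ValiantsHypothesis-21029): for every `n ≥ 3`, Grenet's `(2ⁿ - 1)`-pencil `Λ + Σ_v x_v A_v` has `det = per_n`, and
every direction `(Λ', A')` that is Zariski-tangent to `{det = per_n}` at it and tangent to the rank-profile stratum
(`A'_v ker A_v ⊆ im A_v`) is a gauge direction `(PΛ - ΛQ, PA_v - A_vQ)`.  Composition of the line `grenet_gauge`: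
pencil bookkeeping (`grenet_pencil_eq`), degree-0 tangency + corank-one gauge (`grenet_constGauge`), and linear
rigidity (`grenet_linearRigid_of_blockII_PQ` with the type-II block identity). [cite: Grenet2011, Thm. 1] -/
theorem GrenetFirstOrderRankRigid_of : GrenetFirstOrderRankRigid := by
  intro n hn
  have hN : 2 ^ n = 2 ^ n - 1 + 1 := by
    have := Nat.one_le_two_pow (n := n)
    omega
  -- an enumeration of the subsets of `Fin n`
  obtain ⟨e⟩ : Nonempty (Finset (Fin n) ≃ Fin (2 ^ n - 1 + 1)) :=
    ⟨Fintype.equivFinOfCardEq (by rw [Fintype.card_finset, Fintype.card_fin]; exact hN)⟩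
  refine ⟨fun i j => coeff 0 (Grenet.repr ℂ n e i j),
    fun v i j => coeff (Finsupp.single v 1) (Grenet.repr ℂ n e i j), ?_, ?_⟩
  · have h := grenet_pencil_eq (k := ℂ) n (by omega) hN e
    beta_reduce
    rw [h]
    exact (Grenet.isAffineDetRepr_repr ℂ n (by omega) hN e).2
  · intro Λ' A' htr hC
    exact grenet_linearRigid_of_blockII_PQ e (by omega) hN (grenet_blockII_PQ_placeholder e (by omega) hN) Λ' A' htr hC
      (grenet_constGauge e (by omega) (fun _ _ => rfl) _ Λ' A' htr)

end Summit.ValiantsHypothesis.Theorems.RigidityForcesSymmetry.GrenetGauge
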